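import Mathlib.Analysis.SpecialFunctions.Trigonometric.Bounds
import Literature.Probability.RandomPlanarGeometry.PolygonWinding
import HarnessLib

/-!
# The logarithm along a polygon seen counterclockwise; arguments and the cross product

Continuation of `PolygonWinding.lean` (same setting: a closed polygon `polygonLoop l` and a point
`z` from which every cyclic edge is seen strictly counterclockwise, `cross (v_k - z) (v_{k+1} - z)
> 0`), providing the explicit logarithm as a reusable object and the argument bookkeeping used by
the simplicity criterion of `PolygonStarShaped.lean` (boundary polygons of the grid
approximations `D^R` in [LSW04] §4.3):

* `arg_lt_arg_of_cross_pos` — seen from the upper half-plane the argument is ordered by the cross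
  product (`im v > 0`, `cross u v > 0` give `arg u < arg v`; through `Complex.arg_div_coe_angle`); `arg_lineInterp_lt` — on the segment from `1` to `w` (`im w > 0`)
  the argument stays in `[0, arg w)`; `arg_le_im_div_re` — `arg w ≤ im w / re w` in the open right
  half-plane (`x ≤ tan x`);
* `edgeRatio`, `edgeInterp`, `polygonLog l z hl` — the continuous logarithm of
  `t ↦ polygonLoop l t - z` on `[0, 1]` (`Λ_k + Log((1 - s) + s w_k)` on the `k`-th edge, with
  `vertexLog` from `PolygonWinding.lean`): `continuousOn_polygonLog`, `exp_polygonLog`,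
  `polygonLog_zero`, `polygonLog_one`, `im_vertexLog_sub_eq_sum`;
* `sum_arg_edgeRatio_eq` — `∑_{k<N} arg w_k = 2π · wind (polygonLoop l - z)`;
  `arg_edgeRatio_pos`.
-/

noncomputable section

open Set Function Complex Finset
open Literature.Topology.PlaneTopology

namespace Literature.Probability.RandomPlanarGeometry

/-! ### Comparing arguments in the upper half-plane -/

/-- **The argument is monotone in the cross product, seen from the upper half-plane**: for `v`
with `im v > 0` and any `u`, `cross u v > 0` implies `arg u < arg v`. (If `im u < 0` then
`arg u < 0 < arg v`; `u` cannot be a nonpositive real; otherwise `arg (v/u) = arg v - arg u` as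
real numbers, by `Complex.arg_div_coe_angle`, and `arg (v/u) > 0` since `im (v/u) > 0`.) This
also covers the tree's `arg_lt_arg_sub_one` (`SchwarzChristoffelTriangle.lean`). [folklore] -/
theorem arg_lt_arg_of_cross_pos {u v : ℂ} (hv : 0 < v.im) (huv : 0 < cross u v) : arg u < arg v := by
  have hv0 : v ≠ 0 := by rintro rfl; simp at hv
  have hu0 : u ≠ 0 := by rintro rfl; simp [cross] at huv
  have hargv : 0 < arg v := by
    rcases (Complex.arg_nonneg_iff.2 hv.le).lt_or_eq with h | h
    · exact h
    · exact absurd (Complex.arg_eq_zero_iff.1 h.symm).2 hv.ne'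
  rcases lt_or_ge u.im 0 with hu | hu
  · exact (Complex.arg_neg_iff.2 hu).trans hargv
  have hargu : 0 ≤ arg u := Complex.arg_nonneg_iff.2 hu
  -- `arg u < π`: `u` is not a negative real (that would make the cross product `≤ 0`)
  have hargu' : arg u < Real.pi := by
    rcases (Complex.arg_le_pi u).lt_or_eq with h | h
    · exact h
    · exfalso
      have hre : u.re < 0 := (Complex.arg_eq_pi_iff.1 h).1
      have him : u.im = 0 := (Complex.arg_eq_pi_iff.1 h).2
      rw [cross, him] at huv
      nlinarith
  -- `arg (v / u) = arg v - arg u` as real numbers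
  have hangle := Complex.arg_div_coe_angle hv0 hu0
  have hdiff : -Real.pi < arg v - arg u ∧ arg v - arg u ≤ Real.pi := by
    constructor <;> linarith [Complex.arg_le_pi v]
  have hreal : arg (v / u) = arg v - arg u := by
    have h1 := congrArg Real.Angle.toReal hangle
    rw [Real.Angle.toReal_coe_eq_self_iff.2 ⟨Complex.neg_pi_lt_arg _, Complex.arg_le_pi _⟩,
      ← Real.Angle.coe_sub, Real.Angle.toReal_coe_eq_self_iff.2 hdiff] at h1
    exact h1
  -- and `arg (v / u) > 0` since `im (v / u) > 0`
  have him : 0 < (v / u).im := by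
    rw [im_div_eq_cross_div]
    exact div_pos huv (Complex.normSq_pos.2 hu0)
  have hpos : 0 < arg (v / u) := by
    rcases (Complex.arg_nonneg_iff.2 him.le).lt_or_eq with h | h
    · exact h
    · exact absurd (Complex.arg_eq_zero_iff.1 h.symm).2 him.ne'
  linarith

/-- On the segment from `1` to `w` (`im w > 0`) the argument stays in `[0, arg w)`: for
`s ∈ [0, 1)`, `0 ≤ arg ((1 - s) + s w) < arg w`. [folklore] -/
theorem arg_lineInterp_lt {w : ℂ} (hw : 0 < w.im) {s : ℝ} (hs : s ∈ Ico (0 : ℝ) 1) :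
    0 ≤ arg (1 - s + s * w) ∧ arg (1 - s + s * w) < arg w := by
  have him : (1 - (s : ℂ) + s * w).im = s * w.im := by simp
  refine ⟨Complex.arg_nonneg_iff.2 (by rw [him]; exact mul_nonneg hs.1 hw.le), ?_⟩
  refine arg_lt_arg_of_cross_pos hw ?_
  have : cross (1 - s + s * w) w = (1 - s) * w.im := by
    simp [cross]
    ring
  rw [this]
  exact mul_pos (by linarith [hs.2]) hw

/-- For `w` in the open right half-plane with `im w ≥ 0`: `arg w ≤ im w / re w` (`= tan (arg w)`,
`x ≤ tan x` on `[0, π/2)`). [folklore] -/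
theorem arg_le_im_div_re {w : ℂ} (hre : 0 < w.re) (him : 0 ≤ w.im) : arg w ≤ w.im / w.re := by
  rw [← Complex.tan_arg]
  refine Real.le_tan (Complex.arg_nonneg_iff.2 him) ?_
  have := Complex.abs_arg_lt_pi_div_two_iff.2 (Or.inl hre)
  exact (abs_lt.1 this).2

/-! ### The logarithm along a polygon seen counterclockwise -/

section Polygon

variable {l : List ℂ} {z : ℂ}

/-- The ratio `w_k = (v_{k+1} - z)/(v_k - z)` of consecutive vertices seen from `z` (cyclic
indices). [folklore] -/
def edgeRatio (l : List ℂ) (z : ℂ) (hl : 0 < l.length) (k : ℕ) : ℂ :=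
  (l[(k + 1) % l.length]'(Nat.mod_lt _ hl) - z) / (l[k % l.length]'(Nat.mod_lt _ hl) - z)

/-- The edge ratios have positive imaginary part. [folklore] -/
theorem im_edgeRatio_pos (hl : 0 < l.length)
    (h : ∀ (k : ℕ) (hk : k < l.length),
      0 < cross (l[k] - z) (l[(k + 1) % l.length]'(Nat.mod_lt _ hl) - z)) (k : ℕ) :
    0 < (edgeRatio l z hl k).im := by
  rw [edgeRatio, ratio_mod_eq hl k]
  exact im_ratio_pos hl h _ (Nat.mod_lt _ hl)

/-- `vertexLog (k + 1) = vertexLog k + log (edgeRatio k)`. [folklore] -/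
theorem vertexLog_succ (hl : 0 < l.length) (k : ℕ) :
    vertexLog l z hl (k + 1) = vertexLog l z hl k + Complex.log (edgeRatio l z hl k) := rfl

/-- **The imaginary part of `Λ_k - Λ_0` is the sum of the arguments of the edge ratios.**
[folklore] -/
theorem im_vertexLog_sub_eq_sum (hl : 0 < l.length) (k : ℕ) :
    (vertexLog l z hl k - vertexLog l z hl 0).im =
      ∑ r ∈ Finset.range k, arg (edgeRatio l z hl r) := by
  induction k with
  | zero => simp
  | succ k ih =>
    rw [vertexLog_succ, Finset.sum_range_succ, ← ih, add_sub_right_comm, Complex.add_im,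
      Complex.log_im]

/-- The point `(1 - s) + s w_k` whose logarithm is added along the `k`-th edge. [folklore] -/
def edgeInterp (l : List ℂ) (z : ℂ) (hl : 0 < l.length) (k : ℕ) (s : ℝ) : ℂ :=
  1 - s + s * edgeRatio l z hl k

/-- These points lie in the slit plane (for `s ≥ 0`). [folklore] -/
theorem edgeInterp_mem_slitPlane (hl : 0 < l.length)
    (h : ∀ (k : ℕ) (hk : k < l.length),
      0 < cross (l[k] - z) (l[(k + 1) % l.length]'(Nat.mod_lt _ hl) - z))
    (k : ℕ) {s : ℝ} (hs : 0 ≤ s) : edgeInterp l z hl k s ∈ Complex.slitPlane := by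
  rw [Complex.mem_slitPlane_iff, edgeInterp]
  rcases hs.eq_or_lt with rfl | hs0
  · left; simp
  · right
    have : (1 - (s : ℂ) + s * edgeRatio l z hl k).im = s * (edgeRatio l z hl k).im := by simp
    rw [this]
    exact (mul_pos hs0 (im_edgeRatio_pos hl h k)).ne'

/-- **The logarithm along the polygon**: `Λ_k + Log ((1 - s) + s w_k)` at `t = (k + s)/N`,
`k = ⌊N t⌋`. [folklore] -/
def polygonLog (l : List ℂ) (z : ℂ) (hl : 0 < l.length) (t : ℝ) : ℂ :=
  vertexLog l z hl ⌊(l.length : ℝ) * t⌋₊ +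
    Complex.log (edgeInterp l z hl ⌊(l.length : ℝ) * t⌋₊ (l.length * t - ⌊(l.length : ℝ) * t⌋₊))

/-- The `k`-th piece of `polygonLog` (fixed edge index). [folklore] -/
def polygonLogPiece (l : List ℂ) (z : ℂ) (hl : 0 < l.length) (k : ℕ) (t : ℝ) : ℂ :=
  vertexLog l z hl k + Complex.log (edgeInterp l z hl k (l.length * t - k))

/-- At the left knot the piece is `Λ_k`. [folklore] -/
theorem polygonLogPiece_left (hl : 0 < l.length) (k : ℕ) :
    polygonLogPiece l z hl k ((k : ℝ) / l.length) = vertexLog l z hl k := by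
  have hN : (0 : ℝ) < l.length := by exact_mod_cast hl
  simp [polygonLogPiece, mul_div_cancel₀ _ hN.ne', edgeInterp]

/-- At the right knot the piece is `Λ_{k+1}`. [folklore] -/
theorem polygonLogPiece_right (hl : 0 < l.length) (k : ℕ) :
    polygonLogPiece l z hl k (((k + 1 : ℕ) : ℝ) / l.length) = vertexLog l z hl (k + 1) := by
  have hN : (0 : ℝ) < l.length := by exact_mod_cast hl
  have h1 : (l.length : ℝ) * (((k + 1 : ℕ) : ℝ) / l.length) - k = 1 := by
    rw [mul_div_cancel₀ _ hN.ne']; push_cast; ring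
  have h2 : edgeInterp l z hl k 1 = edgeRatio l z hl k := by simp [edgeInterp]
  simp only [polygonLogPiece, h1, h2]
  rfl

/-- From `t ∈ [k/N, (k+1)/N]`: `k ≤ N t ≤ k + 1`. [folklore] -/
private theorem le_mul_and_mul_le (hl : 0 < l.length) {k : ℕ} {t : ℝ}
    (ht : t ∈ Icc ((k : ℝ) / l.length) (((k + 1 : ℕ) : ℝ) / l.length)) :
    (k : ℝ) ≤ l.length * t ∧ (l.length : ℝ) * t ≤ k + 1 := by
  have hN : (0 : ℝ) < l.length := by exact_mod_cast hl
  constructor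
  · have := ht.1; rw [div_le_iff₀ hN] at this; linarith
  · have := ht.2; rw [le_div_iff₀ hN] at this; push_cast at this; linarith

/-- `polygonLog` agrees with its `k`-th piece on the closed `k`-th parameter interval. [folklore] -/
theorem polygonLog_eqOn_piece (hl : 0 < l.length) (k : ℕ) :
    EqOn (polygonLog l z hl) (polygonLogPiece l z hl k)
      (Icc ((k : ℝ) / l.length) (((k + 1 : ℕ) : ℝ) / l.length)) := by
  have hN : (0 : ℝ) < l.length := by exact_mod_cast hl
  intro t ht
  obtain ⟨h1, h2⟩ := le_mul_and_mul_le hl ht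
  rcases h2.lt_or_eq with hlt | heq
  · simp only [polygonLog, polygonLogPiece, Nat.floor_eq_on_Ico k _ ⟨h1, hlt⟩]
  · have ht' : t = ((k + 1 : ℕ) : ℝ) / l.length := by
      rw [eq_div_iff hN.ne']; push_cast; linarith
    have hfl : ⌊(l.length : ℝ) * t⌋₊ = k + 1 := by
      rw [heq]; exact_mod_cast Nat.floor_natCast (R := ℝ) (k + 1)
    have : polygonLog l z hl t = polygonLogPiece l z hl (k + 1) t := by
      simp only [polygonLog, polygonLogPiece, hfl]
    rw [this, ht', polygonLogPiece_left, polygonLogPiece_right]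

/-- Each piece is continuous on its interval. [folklore] -/
theorem continuousOn_polygonLogPiece (hl : 0 < l.length)
    (h : ∀ (k : ℕ) (hk : k < l.length),
      0 < cross (l[k] - z) (l[(k + 1) % l.length]'(Nat.mod_lt _ hl) - z)) (k : ℕ) :
    ContinuousOn (polygonLogPiece l z hl k)
      (Icc ((k : ℝ) / l.length) (((k + 1 : ℕ) : ℝ) / l.length)) := by
  have hcq : Continuous fun t : ℝ ↦ edgeInterp l z hl k (l.length * t - k) := by
    unfold edgeInterp; fun_prop
  intro t ht
  obtain ⟨h1, h2⟩ := le_mul_and_mul_le hl ht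
  have hs : (l.length : ℝ) * t - k ∈ Icc (0 : ℝ) 1 := ⟨by linarith, by linarith⟩
  have hc : ContinuousAt (fun t : ℝ ↦ Complex.log (edgeInterp l z hl k (l.length * t - k))) t :=
    ContinuousAt.comp (g := Complex.log) (f := fun t : ℝ ↦ edgeInterp l z hl k (l.length * t - k))
      (continuousAt_clog (edgeInterp_mem_slitPlane hl h k hs.1)) hcq.continuousAt
  exact (continuousAt_const.add hc).continuousWithinAt

/-- `[0, 1]` is the union of the `N` parameter intervals. [folklore] -/
private theorem Icc_eq_iUnion_pieces (hl : 0 < l.length) :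
    Icc (0 : ℝ) 1 = ⋃ k : Fin l.length,
      Icc (((k : ℕ) : ℝ) / l.length) ((((k : ℕ) + 1 : ℕ) : ℝ) / l.length) := by
  have hN : (0 : ℝ) < l.length := by exact_mod_cast hl
  apply Set.Subset.antisymm
  · intro t ht
    have ht0 : 0 ≤ (l.length : ℝ) * t := mul_nonneg hN.le ht.1
    rcases ht.2.lt_or_eq with hlt | rfl
    · have hk : ⌊(l.length : ℝ) * t⌋₊ < l.length := (Nat.floor_lt ht0).2 (by nlinarith)
      refine mem_iUnion.2 ⟨⟨_, hk⟩, ?_, ?_⟩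
      · rw [div_le_iff₀ hN]
        have := Nat.floor_le ht0
        linarith
      · rw [le_div_iff₀ hN]; push_cast
        have := Nat.lt_floor_add_one ((l.length : ℝ) * t); linarith
    · obtain ⟨n, hn⟩ : ∃ n, l.length = n + 1 := ⟨l.length - 1, by omega⟩
      refine mem_iUnion.2 ⟨⟨n, by omega⟩, ?_, ?_⟩
      · rw [div_le_iff₀ hN, one_mul]; exact_mod_cast (by omega : n ≤ l.length)
      · rw [le_div_iff₀ hN, one_mul]; exact_mod_cast (by omega : l.length ≤ n + 1)
  · intro t ht
    obtain ⟨k, hk⟩ := mem_iUnion.1 ht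
    refine ⟨le_trans (by positivity) hk.1, hk.2.trans ?_⟩
    rw [div_le_one hN]; exact_mod_cast k.2

/-- **`polygonLog` is continuous on `[0, 1]`.** [folklore] -/
theorem continuousOn_polygonLog (hl : 0 < l.length)
    (h : ∀ (k : ℕ) (hk : k < l.length),
      0 < cross (l[k] - z) (l[(k + 1) % l.length]'(Nat.mod_lt _ hl) - z)) :
    ContinuousOn (polygonLog l z hl) (Icc 0 1) := by
  rw [Icc_eq_iUnion_pieces hl]
  exact LocallyFinite.continuousOn_iUnion (locallyFinite_of_finite _) (fun _ ↦ isClosed_Icc)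
    fun k ↦ (continuousOn_polygonLogPiece hl h k).congr (polygonLog_eqOn_piece hl k)

/-- `polygonLog 0 = Λ_0`. [folklore] -/
theorem polygonLog_zero (hl : 0 < l.length) : polygonLog l z hl 0 = vertexLog l z hl 0 := by
  simp [polygonLog, edgeInterp]

/-- `polygonLog 1 = Λ_N`. [folklore] -/
theorem polygonLog_one (hl : 0 < l.length) :
    polygonLog l z hl 1 = vertexLog l z hl l.length := by
  have hN : (0 : ℝ) < l.length := by exact_mod_cast hl
  obtain ⟨n, hn⟩ : ∃ n, l.length = n + 1 := ⟨l.length - 1, by omega⟩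
  have h1 : (1 : ℝ) = ((n + 1 : ℕ) : ℝ) / l.length := by rw [← hn, div_self hN.ne']
  have hmem : (1 : ℝ) ∈ Icc ((n : ℝ) / l.length) (((n + 1 : ℕ) : ℝ) / l.length) := by
    refine ⟨?_, h1.le⟩
    rw [div_le_one hN]; exact_mod_cast (by omega : n ≤ l.length)
  rw [polygonLog_eqOn_piece hl n hmem, h1, polygonLogPiece_right, ← hn]

/-- **`polygonLog` is a logarithm of the loop `polygonLoop l - z` on `[0, 1]`.** [folklore] -/
theorem exp_polygonLog (hl : 0 < l.length)
    (h : ∀ (k : ℕ) (hk : k < l.length),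
      0 < cross (l[k] - z) (l[(k + 1) % l.length]'(Nat.mod_lt _ hl) - z))
    {t : ℝ} (ht : t ∈ Icc (0 : ℝ) 1) : Complex.exp (polygonLog l z hl t) = polygonLoop l t - z := by
  have hN : (0 : ℝ) < l.length := by exact_mod_cast hl
  have ht0 : 0 ≤ (l.length : ℝ) * t := mul_nonneg hN.le ht.1
  rcases ht.2.lt_or_eq with hlt | rfl
  · set k := ⌊(l.length : ℝ) * t⌋₊ with hk
    have hks : (k : ℝ) ≤ l.length * t := Nat.floor_le ht0
    have hsk : (l.length : ℝ) * t < k + 1 := Nat.lt_floor_add_one _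
    have hkN : k < l.length := (Nat.floor_lt ht0).2 (by nlinarith)
    have hs : (l.length : ℝ) * t - k ∈ Icc (0 : ℝ) 1 := ⟨by linarith, by linarith⟩
    have ht' : t = (k + ((l.length : ℝ) * t - k)) / l.length := by field_simp; ring
    have e1 : l[k % l.length]'(Nat.mod_lt _ hl) = l[k] := getElem_congr_idx (Nat.mod_eq_of_lt hkN)
    have hne := sub_ne_zero_of_cross_pos hl h k hkN
    have hval : polygonLog l z hl t = vertexLog l z hl k +
        Complex.log (edgeInterp l z hl k (l.length * t - k)) := rfl
    rw [hval, Complex.exp_add, exp_vertexLog hl h k,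
      Complex.exp_log (Complex.slitPlane_ne_zero (edgeInterp_mem_slitPlane hl h k hs.1)), e1]
    conv_rhs => rw [ht', polygonLoop_apply_div hkN hs]
    rw [AffineMap.lineMap_apply_module', Complex.real_smul]
    simp only [edgeInterp, edgeRatio, e1]
    field_simp
    ring
  · rw [polygonLog_one, exp_vertexLog hl h l.length]
    have hp : polygonLoop l 1 = l[0] := by
      have h0 := polygonLoop_vertex (l := l) (k := 0) hl
      rw [Nat.cast_zero, zero_div] at h0
      rw [← h0]
      simpa using periodic_polygonLoop l 0
    have e0 : l[l.length % l.length]'(Nat.mod_lt _ hl) = l[0] := getElem_congr_idx (Nat.mod_self _)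
    rw [e0, hp]

/-- **The total argument is `2π` times the winding number**: `∑_{k<N} arg w_k = 2π · wind`.
[folklore] -/
theorem sum_arg_edgeRatio_eq (hl : 0 < l.length)
    (h : ∀ (k : ℕ) (hk : k < l.length),
      0 < cross (l[k] - z) (l[(k + 1) % l.length]'(Nat.mod_lt _ hl) - z)) :
    ∑ k ∈ Finset.range l.length, arg (edgeRatio l z hl k) =
      2 * Real.pi * wind (fun t ↦ polygonLoop l t - z) := by
  have h01 : (fun t ↦ polygonLoop l t - z) 0 = (fun t ↦ polygonLoop l t - z) 1 := by
    have := periodic_polygonLoop l 0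
    simp only [zero_add] at this
    simp only [this]
  have hspec := wind_spec (continuousOn_polygonLog hl h) (fun t ht ↦ exp_polygonLog hl h ht) h01
  rw [polygonLog_one, polygonLog_zero] at hspec
  have him := congrArg Complex.im hspec
  rw [im_vertexLog_sub_eq_sum] at him
  simp only [Complex.mul_im, Complex.intCast_re, Complex.intCast_im, zero_mul, add_zero,
    Complex.mul_re, Complex.re_ofNat, Complex.im_ofNat, Complex.ofReal_re, Complex.ofReal_im,
    Complex.I_re, Complex.I_im, mul_zero, sub_zero, mul_one] at him
  rw [him]
  ring

/-- Each edge ratio has strictly positive argument. [folklore] -/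
theorem arg_edgeRatio_pos (hl : 0 < l.length)
    (h : ∀ (k : ℕ) (hk : k < l.length),
      0 < cross (l[k] - z) (l[(k + 1) % l.length]'(Nat.mod_lt _ hl) - z)) (k : ℕ) :
    0 < arg (edgeRatio l z hl k) := by
  have him := im_edgeRatio_pos hl h k
  rcases (Complex.arg_nonneg_iff.2 him.le).lt_or_eq with hpos | h0
  · exact hpos
  · exact absurd (Complex.arg_eq_zero_iff.1 h0.symm).2 him.ne'

end Polygon

end Literature.Probability.RandomPlanarGeometry
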